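import Summits.ResolutionOfSingularities.ResolutionOfSingularities.Theorems.HilbertSamuelEliminationSigmaMaxModificationsCorridor3WLadderIsoRestartSimStep
import Summits.ResolutionOfSingularities.ResolutionOfSingularities.Theorems.HilbertSamuelEliminationSigmaMaxModificationsCorridor3WLadderIsoRestartSimInit
import Summits.ResolutionOfSingularities.ResolutionOfSingularities.Theorems.HilbertSamuelEliminationSigmaMaxModificationsCorridor3WLadderIsoRestart
import Summits.ResolutionOfSingularities.ResolutionOfSingularities.Theorems.HilbertSamuelEliminationSigmaMaxModificationsCorridor3OriginAlongReaches
import HarnessLib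

/-!
# [OURS · L1 W4.2] D8-S1 file 8: `LocalRunSimulationM p` HOLDS — the run-level Zariski localisation of the labelled canonical-step machine
# for LOCAL oracles (crux chain w42; closes, with `isoOpenRestartM_oracleLocal_of_simulation` p514459, the registered stub
# `stub_isoOpenRestartLocal : ∀ p, p.Prime → IsoOpenRestartM OracleLocal p` of the skeleton `w_ladder` v7 / v8.1 BY NAME; hand res-D-pv-060)

OURS (cell `res-hironaka`, slot W4.2, crux `stmt-ResolutionOfSingularities-18506` / conjunct `-19249`; `--supports … --as helper`, counted 0);
NOT a statement of the manuscript under review [claim: Hironaka2017, status: under-review] nor of [CossartJannsenSaito2020] (POINTER: Thm. 1.2's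
functoriality, Rem. 6.29 (1)). AI proof, weaker than expert review.

`localRunSimulationM_holds p : LocalRunSimulationM p` (row typed in `…IsoRestartDefs`, p513760). Proof: at the regular value `ν = Φ^{(3)}` no
chain exists (`…Corridor3RegularValue`); otherwise every global stage carries the cycle invariant (`exists_cycleInv_chain`), the restart stage
carries the history relation (`histRel_of_reaches`) and the pointed open is a maximal origin (`IsMaximalOrigin.opens`), so `SimRel.init` gives
the state at `m = 0` and `SimRel.step` (by `Classical.choice`, `Nat.rec`) a state over every global stage; the open's chain `c'` is read off at
the global times where the open steps (`Nat.nth`), the re-indexing is `ψ m = Nat.count (the open steps) m`, and `ι m` are the states' open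
immersions transported along `c' (ψ m) = u_m` (the open's stage is constant between its steps). The simulation is characteristic-free (`p`
enters only through the maximal-origin scope). [folklore]
-/

noncomputable section

set_option linter.dupNamespace false -- mandated namespace of this single-conjunct summit

open CategoryTheory CategoryTheory.Limits AlgebraicGeometry TopologicalSpace
open Summit.ResolutionOfSingularities.ResolutionOfSingularities.Theorems.CampaignW42
open Literature.AlgebraicGeometry.Resolution Literature.RingTheory.HilbertSamuel
open Literature.AlgebraicGeometry.CossartJannsenSaito2020
open Summit.ResolutionOfSingularities.ResolutionOfSingularities.Theorems.SigmaMaxModificationsCorridor3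
open Summit.ResolutionOfSingularities.ResolutionOfSingularities.Theorems.SigmaMaxModificationsCorridor3.Moving
open Summit.ResolutionOfSingularities.ResolutionOfSingularities.Theorems.SigmaMaxModificationsCorridor3.Helpers (QPointed)

universe u

namespace Summit.ResolutionOfSingularities.ResolutionOfSingularities.Cruxes.SigmaMaxModifications.IdeasL1Idea2R4

variable {R : ∀ S : Scheme.{u}, CentreSeq S → Prop} {N : ℕ} {ν : ℕ → ℕ}

/-! ## §7. Extraction: the proof of the run-level Zariski localisation row -/

section Extraction

/-- Transport of the marked point along an equality of marked stages. [folklore] -/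
theorem eqToHom_base_pt {a b : MarkedStage.{u}} (e : a = b) : (eqToHom (congrArg MarkedStage.W e)).base a.pt = b.pt := by
  subst e
  simp

/-- [OURS · D8-S1] **THE RUN-LEVEL ZARISKI LOCALISATION ROW `LocalRunSimulationM p` HOLDS** (every prime `p`; in fact the simulation is
characteristic-free): the run of the pointed open `(U, x_{c 0})` from its initial marked stage simulates the chain `c` over `U` —
re-indexing `ψ m = #{i < m | the open steps at i}`, `c' k =` the open's stage after its `k`-th step, `ι m` the open immersions of the
simulation states (`SimRel.init`, `SimRel.step`), every genuine global step a genuine step of the open. With `isoOpenRestartM_oracleLocal_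
of_simulation` (p514459) this closes the registered stub `stub_isoOpenRestartLocal` of the crux skeleton `w_ladder` (v7/v8.1).
[cite: CossartJannsenSaito2020, Thm. 1.2, Rem. 6.29 (1)] -/
theorem localRunSimulationM_holds (p : ℕ) : LocalRunSimulationM.{u} p := by
  intro R hRf hRa hRl ν X _ x hX c h0 hstep hmov U hU h₀ hUpt
  -- the regular value carries no chain at all
  by_cases hν : ν = iterPSum 3 Phi
  · exact absurd ⟨c, Relation.ReflTransGen.refl, hstep, fun _ => trivial⟩
      (hX.noNearChainFrom_of_reaches_of_eq_iterPSum hRa hν h0 fun _ => True)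
  -- the global chain: cycle invariant, marked points in the strata, history of the pending cycle at `c 0`
  obtain ⟨k, _, hcyc⟩ := exists_cycleInv_chain hRa hν hX h0 hstep
  have hreach : ∀ m, Reaches R 3 ν (MarkedStage.init X x) (c m) := reaches_chain h0 hstep
  have hspt : ∀ m, (c m).pt ∈ Scheme.hsStratum (c m).W 3 ν := fun m => Moving.pt_mem_hsStratum_of_reaches hX.mem_stratum (hreach m)
  haveI : IsLocallyNoetherian (c 0).W := (c 0).ln
  have hptcl : IsClosed ({(c 0).pt} : Set (c 0).W) := Reaches.isClosed_pt hX.isClosed (hreach 0)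
  -- the open side: a pointed maximal origin with its cycle invariant
  have hUorig : IsMaximalOrigin p 3 ν (U : Scheme.{u}) ⟨(c 0).pt, h₀⟩ := (hX.of_reaches hRa (hreach 0)).opens U h₀
  obtain ⟨k', _, hUcyc⟩ := hUorig.exists_cycleInv (R := R)
  have hrel0 : SimRel k' R 3 ν (c 0) (@MarkedStage.init (U : Scheme.{u}) hU ⟨(c 0).pt, h₀⟩) U.ι :=
    SimRel.init hRl (hcyc 0) hptcl (histRel_of_reaches (hreach 0)) U hU h₀ hUpt hUcyc
  -- the simulation: one state over every global stage
  let St : ℕ → Type (u + 1) := fun m => {q : Σ u : MarkedStage.{u}, (u.W ⟶ (c m).W) // SimRel k' R 3 ν (c m) q.1 q.2}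
  have stepEx : ∀ m (q : St m), ∃ q' : St (m + 1), (q'.1.1 = q.1.1 ∨ CanonicalNearStep R 3 ν q.1.1 q'.1.1) ∧
      ((c m).IsBlownUp R 3 ν → CanonicalNearStep R 3 ν q.1.1 q'.1.1 ∧ q.1.1.IsBlownUp R 3 ν) := fun m q => by
    obtain ⟨u', ι', hrel, hor, hb⟩ := SimRel.step hRf hRa hRl hν (hcyc m) (hspt m) q.2 (hstep m)
    exact ⟨⟨⟨u', ι'⟩, hrel⟩, hor, hb⟩
  let q0 : St 0 := ⟨⟨@MarkedStage.init (U : Scheme.{u}) hU ⟨(c 0).pt, h₀⟩, U.ι⟩, hrel0⟩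
  let seq : ∀ m, St m := fun m => Nat.rec (motive := St) q0 (fun m q => Classical.choose (stepEx m q)) m
  have hseq : ∀ m, ((seq (m + 1)).1.1 = (seq m).1.1 ∨ CanonicalNearStep R 3 ν (seq m).1.1 (seq (m + 1)).1.1) ∧
      ((c m).IsBlownUp R 3 ν → CanonicalNearStep R 3 ν (seq m).1.1 (seq (m + 1)).1.1 ∧ (seq m).1.1.IsBlownUp R 3 ν) :=
    fun m => Classical.choose_spec (stepEx m (seq m))
  -- the open's stage along global time, and the global times at which the open steps
  let v : ℕ → MarkedStage.{u} := fun m => (seq m).1.1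
  let stepped : ℕ → Prop := fun m => CanonicalNearStep R 3 ν (v m) (v (m + 1))
  haveI := Classical.decPred stepped
  have hidle : ∀ m, ¬ stepped m → v (m + 1) = v m := fun m hm => ((hseq m).1).resolve_right hm
  have hconst : ∀ a b, a ≤ b → (∀ l, a ≤ l → l < b → ¬ stepped l) → v b = v a := by
    intro a b hab hno
    induction b, hab using Nat.le_induction with
    | base => rfl
    | succ b hab ih =>
      rw [hidle b (hno b hab (Nat.lt_succ_self b))]
      exact ih fun l hl hlb => hno l hl (hlb.trans (Nat.lt_succ_self b))
  have hinf : (setOf stepped).Infinite := by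
    refine Set.infinite_of_forall_exists_gt fun n => ?_
    obtain ⟨m, hnm, hb⟩ := hmov (n + 1)
    exact ⟨m, (hseq m).2 hb |>.1, Nat.lt_of_succ_le hnm⟩
  -- between consecutive steps the open's stage is constant
  have hgap : ∀ m, v (Nat.nth stepped (Nat.count stepped m)) = v m := by
    intro m
    refine hconst m _ (Nat.le_nth_count hinf m) fun l hml hl hsl => ?_
    have h1 : Nat.count stepped (l + 1) ≤ Nat.count stepped m := by
      have := Nat.count_monotone stepped (Nat.succ_le_of_lt hl)
      rwa [Nat.count_nth_of_infinite hinf] at this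
    have h2 : Nat.count stepped m ≤ Nat.count stepped l := Nat.count_monotone stepped hml
    rw [Nat.count_succ, if_pos hsl] at h1
    omega
  have hnext : ∀ j, v (Nat.nth stepped (j + 1)) = v (Nat.nth stepped j + 1) := by
    intro j
    refine hconst _ _ (Nat.succ_le_of_lt (Nat.nth_strictMono hinf (Nat.lt_succ_self j))) fun l hjl hl hsl => ?_
    obtain ⟨i, -, hi⟩ := Nat.exists_lt_card_nth_eq hsl
    rw [← hi] at hjl hl
    have h1 : j < i := (Nat.nth_lt_nth hinf).mp (Nat.lt_of_succ_le hjl)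
    have h2 : i < j + 1 := (Nat.nth_lt_nth hinf).mp hl
    omega
  -- the data
  let c' : ℕ → MarkedStage.{u} := fun j => v (Nat.nth stepped j)
  let ψ : ℕ → ℕ := fun m => Nat.count stepped m
  have hcv : ∀ m, c' (ψ m) = v m := hgap
  refine ⟨c', ψ, fun m => eqToHom (congrArg MarkedStage.W (hcv m)) ≫ (seq m).1.2, ?_, Nat.count_zero _, ?_, ?_, ?_, ?_⟩
  · -- `c' 0` is the initial stage of the open
    show v (Nat.nth stepped 0) = v 0
    refine hconst 0 _ (Nat.zero_le _) fun l _ hl hsl => ?_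
    rw [Nat.nth_zero] at hl
    exact Nat.notMem_of_lt_sInf hl hsl
  · -- the open's chain consists of canonical near steps
    intro j
    show CanonicalNearStep R 3 ν (v (Nat.nth stepped j)) (v (Nat.nth stepped (j + 1)))
    rw [hnext j]
    exact Nat.nth_mem_of_infinite hinf j
  · -- open immersions, marked point to marked point
    intro m
    haveI := (seq m).2.isOpenImmersion
    refine ⟨inferInstance, ?_⟩
    rw [Scheme.Hom.comp_base, TopCat.coe_comp, Function.comp_apply, eqToHom_base_pt (hcv m)]
    exact (seq m).2.base_pt
  · -- `ψ` steps by `0` or `1`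
    intro m
    show Nat.count stepped (m + 1) = Nat.count stepped m ∨ Nat.count stepped (m + 1) = Nat.count stepped m + 1
    rw [Nat.count_succ]
    by_cases h : stepped m
    · rw [if_pos h]; exact Or.inr rfl
    · rw [if_neg h]; exact Or.inl rfl
  · -- genuine global steps are genuine steps of the open
    intro m hb
    obtain ⟨hst, hbu⟩ := (hseq m).2 hb
    refine ⟨?_, ?_⟩
    · show Nat.count stepped (m + 1) = Nat.count stepped m + 1
      rw [Nat.count_succ, if_pos hst]
    · show (c' (ψ m)).IsBlownUp R 3 ν
      rw [hcv m]
      exact hbu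

end Extraction


end Summit.ResolutionOfSingularities.ResolutionOfSingularities.Cruxes.SigmaMaxModifications.IdeasL1Idea2R4

/-! ## The registered stub of the crux skeleton, closed by name -/

namespace Summit.ResolutionOfSingularities.ResolutionOfSingularities.Cruxes.SigmaMaxModificationsCorridor3.WLadder

open Summit.ResolutionOfSingularities.ResolutionOfSingularities.Cruxes.SigmaMaxModifications.IdeasL1Idea2R4

/-- [OURS · L1 W4.2] **THE REGISTERED STUB `stub_isoOpenRestartLocal` OF THE SKELETON `w_ladder` (v7 b2b6995cc2e5c83b / v8.1 / v8.2
7d55dd5b118e49fc), SIGNATURE VERBATIM, CLOSED**: restart at isolated stages for LOCAL oracles, `IsoOpenRestartM OracleLocal p` for every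
prime `p` — by `isoOpenRestartM_oracleLocal_of_simulation` (p514459) fed with `localRunSimulationM_holds`. OURS; NOT a statement of the
manuscript. [cite: CossartJannsenSaito2020, Thm. 1.1, Thm. 1.2, Rem. 6.29] -/
theorem stub_isoOpenRestartLocal : ∀ p : ℕ, p.Prime → IsoOpenRestartM.{0} OracleLocal.{0} p :=
  fun p _ => isoOpenRestartM_oracleLocal_of_simulation p (localRunSimulationM_holds p)

end Summit.ResolutionOfSingularities.ResolutionOfSingularities.Cruxes.SigmaMaxModificationsCorridor3.WLadder

end
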